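import Literature.Algebra.Homology.TateNakayamaInflationVanishingHom
import HarnessLib

/-!
# Milne I Lemma 1.9's engine on `ℓ`-parts (the `P`-class-formation clause): a class of `Hⁿ⁺³(G, C ⊗ N)`,
# `Hⁿ⁺³(G, C)` or `Hⁿ⁺³(G, Hom(N, C))` KILLED BY `e` dies under an inflation `Inf_π` with
# `Inf_π[φ] = d·[φ₁]` as soon as `e ∣ d` (Harari Lemma 16.20 with Remark 16.24 (b) / Thm. 17.18)

Topic `Algebra/Homology`; namespace `Literature.Algebra.Homology`.  Theorems only; no definition, no named
fact, no instance, no `sorry`.  Sequel of `TateNakayamaCupProductInflation` (door-c6 g11: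
`map_cupProductRep_H2π_eq_nsmul`, `IsClassModule.cupProductRep_self_bijective`,
`IsClassModule.map_eq_zero_of_card_dvd`), `TateNakayamaInflationVanishingPlain` (door-c6 g15:
`map_map_rightUnitor_apply`, `IsClassModule.map_eq_zero_of_card_dvd_plain`) and
`TateNakayamaInflationVanishingHom` (door-c6 g15: `map_tensorDualHom_comp_map_ihomTransition`,
`IsClassModule.map_ihom_eq_zero_of_card_dvd`).

THE POINT.  The tree's engine kills `Hⁿ⁺³(G, C ⊗ N) → Hⁿ⁺³(G₁, C₁ ⊗ Res_π N)` when the tower constant `d`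
(`Inf_π[φ] = d·[φ₁]`, `Inf u_{G/U} = (U:V)·u_{G/V}` in a class formation) is divisible by `|G|`: every class is
`[φ] ∪ x` with `x ∈ Hⁿ⁺¹(G, N)` (Tate–Nakayama), `Inf_π([φ] ∪ x) = [φ₁] ∪ (d · Inf_π x)`, and `|G| · x = 0`.
For a `P`-CLASS FORMATION (Harari Remark 16.24 (b): `inv_U` only injective, `H²(U, C){ℓ} ≅ ℚ_ℓ/ℤ_ℓ` only for
`ℓ ∈ P`) — the case of the `S`-idèle class formation `(G_S, C_S)` of a number field (Harari Thm. 17.2, Remark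
17.1: `ℓ ∈ P` iff `ℓ^∞ ∣ #G_S`) — the layers `V ≤ U` available inside the formation need NOT have `|G/U| ∣ (U:V)`;
what one has is `ℓ^a ∣ (U:V)` for `ℓ ∈ P` and every `a` (cyclotomic layers).  The SAME computation kills every
class `y` with `e · y = 0` as soon as `e ∣ d`: `y = [φ] ∪ x` with `e · x = 0` (the cup isomorphism is additive
and injective), `d · Inf_π x = (d/e) · Inf_π (e · x) = 0`.  Hence `lim→ Hʳ(G/U, C^U){ℓ} = 0` for `r ≥ 3` along any
tower whose indices are divisible by arbitrarily large powers of `ℓ` — the `ℓ`-primary half of Milne I Lemma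
1.9 / Harari Lemma 16.20 that Harari §16.4 («Theorem 16.21 extends to `P`-class formations provided one
restricts everywhere to `ℓ`-primary components, `ℓ ∈ P`») and Thm. 17.18 use.

## What is formalised

* §1 **`map_cupProductRep_H2π_eq_zero_of_nsmul_eq_zero`** — `Inf_π([φ₂] ∪ x) = 0` when `Inf_π[φ₂] = d·[φ₁]`,
  `e · x = 0` and `e ∣ d` (any `π : G₁ → G₂`, any coefficient ring; no finiteness).
* §2 for a CLASS MODULE `(G, C, [φ])` (`G` finite, over `ℤ`), `π : G₁ → G`, `ι : Res_π C → C₁`, a `2`-cocycle `φ₁`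
  of `C₁` with `Inf_π[φ] = d·[φ₁]`, and `e ∣ d`:
  **`IsClassModule.map_eq_zero_of_nsmul_eq_zero`** (coefficients `C ⊗ N`, `N` torsion-free: every
  `y ∈ Hⁿ⁺³(G, C ⊗ N)` with `e · y = 0` has `Inf_π y = 0`);
  **`IsClassModule.map_eq_zero_of_nsmul_eq_zero_plain`** (plain coefficients `C`);
  **`IsClassModule.map_ihom_eq_zero_of_nsmul_eq_zero`** (coefficients `Hom(N, C)`, `N` a `G`-lattice, with the
  freedom `N₁ ≃ Res_π N` of the `Hom`-engine);
  and the `addOrderOf`-forms `…_of_addOrderOf_dvd` (`addOrderOf y ∣ d ⇒ Inf_π y = 0`), which is how a colimit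
  argument consumes them (pick the deeper layer with `(U:V)` divisible by the order of the class).
* (the tree's `|G| ∣ d` engine `IsClassModule.map_eq_zero_of_card_dvd_plain` is the special case `e = |G|` of
  the plain form, by `card_smul_eq_zero_groupCohomology_succ`; not restated here.)

Written for the background lane «PT-Ш-S-TC» of cell `bsd-eis` (crux `GoodLatticeBDPValue`,
stmt-BirchSwinnertonDyer-19032; by-name input #9 road «SUR-Λ», input D = Milne ADT I Thm. 4.10 (a) for `G_S`):
the fields `ext_triv_eq_zero_of_nsmul_eq_zero` / `ext_eq_zero_of_four_le` (`r ≥ 3` / `r ≥ 4`, `p`-primary) of the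
`p`-primary duality hypotheses `TateDualityHypothesesAt p` for `(G_S, C̄_S)` are colimits of exactly these layer
statements.  Seat bsd-line-x1-p1-w4 g19.  HONEST FRAMING: finite-group cohomology only; no arithmetic statement,
no duality theorem and no case of BSD is proved here.

## References
* J. S. Milne, *Arithmetic Duality Theorems* (2nd ed. 2006), I §1, Lemma 1.9 (proof) and the remark before
  Thm. 1.8 on `P`-class formations; I §4 (the `S`-idèle class formation is a `P`-class formation). [MilneADT2006]
* D. Harari, *Galois Cohomology and Class Field Theory* (2020), §16.3 Lemma 16.20, §16.4 Remark 16.24 (b)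
  («restrict everywhere to `ℓ`-primary components»), §17.1 Remark 17.1, Thm. 17.2, Thm. 17.18. [Harari2020]
* K. S. Brown, *Cohomology of Groups*, GTM 87 (1982), V §3 (3.7), III Cor. 10.2. [Brown1982CohomologyGroups]
-/

noncomputable section

open CategoryTheory CategoryTheory.Limits MonoidalCategory groupCohomology

universe u

namespace Literature.Algebra.Homology

/-! ## §1 Inflation of a Tate–Nakayama class `[φ₂] ∪ x` with `e · x = 0`, `e ∣ d` -/

section Inflation

variable {k : Type u} [CommRing k] {G₁ G₂ : Type u} [Group G₁] [Group G₂] (π : G₁ →* G₂)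
  {C₂ N : Rep.{u} k G₂} {C₁ : Rep.{u} k G₁} (ι : Rep.res π C₂ ⟶ C₁) {q m : ℕ}

/-- **`Inf_π([φ₂] ∪ x) = 0` when `Inf_π[φ₂] = d·[φ₁]`, `e · x = 0` and `e ∣ d`** (any degree `q`, any
`π : G₁ → G₂`): `Inf_π([φ₂] ∪ x) = [φ₁] ∪ (d · Inf_π x)` and `d · Inf_π x = (d/e) · Inf_π(e · x) = 0`.  The
`ℓ`-primary mechanism of Milne I Lemma 1.9 for a `P`-class formation: the transition `(U:V)·Inf` kills the
classes of order dividing `(U:V)`.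
[cite: MilneADT2006, Ch. I, Lemma 1.9 (proof)] [cite: Harari2020, Lemma 16.20, Remark 16.24 (b)] -/
theorem map_cupProductRep_H2π_eq_zero_of_nsmul_eq_zero (φ₂ : cocycles₂ C₂) (φ₁ : cocycles₂ C₁) {d e : ℕ}
    (hι : map π ι 2 (H2π C₂ φ₂) = d • H2π C₁ φ₁) (he : e ∣ d) (h : 2 + q = m)
    (x : groupCohomology N q) (hx : e • x = 0) :
    map π (resTensorHom C₂ N π ≫ (ι ⊗ₘ 𝟙 (Rep.res π N))) m (cupProductRep C₂ N h (H2π C₂ φ₂) x) = 0 := by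
  rw [map_cupProductRep_H2π_eq_nsmul π ι φ₂ φ₁ hι h x, ← map_nsmul]
  obtain ⟨c, rfl⟩ := he
  rw [mul_nsmul, hx, smul_zero, map_zero, map_zero]

end Inflation

/-! ## §2 Class modules: the classes of `Hⁿ⁺³` killed by `e` die under `Inf_π` when `e ∣ d` -/

section ClassModule

variable {G : Type} [Group G] [Fintype G] {C : Rep.{0} ℤ G} {φ : cocycles₂ C}
variable {G₁ : Type} [Group G₁] (π : G₁ →* G) {C₁ : Rep.{0} ℤ G₁} (ι : Rep.res π C ⟶ C₁)

/-- **Tensor coefficients.**  For a class module `(G, C, [φ])` (`G` finite), a torsion-free `N`, `π : G₁ → G`,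
a `G₁`-module `C₁` with a `2`-cocycle `φ₁` and a `G₁`-map `ι : Res_π C → C₁` with `Inf_π[φ] = d·[φ₁]`, and `e ∣ d`:
every `y ∈ Hⁿ⁺³(G, C ⊗ N)` with `e · y = 0` satisfies `Inf_π y = 0` (`y = [φ] ∪ x` by the Tate–Nakayama cup
isomorphism, which is additive and injective, so `e · x = 0`; then §1).
[cite: MilneADT2006, Ch. I, Lemma 1.9] [cite: Harari2020, Lemma 16.20, §16.4 Remark 16.24 (b)] -/
theorem IsClassModule.map_eq_zero_of_nsmul_eq_zero (hC : IsClassModule C φ) (N : Rep.{0} ℤ G)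
    [IsAddTorsionFree N.V] (φ₁ : cocycles₂ C₁) {d e : ℕ} (hι : map π ι 2 (H2π C φ) = d • H2π C₁ φ₁)
    (he : e ∣ d) (n : ℕ) (y : groupCohomology (C ⊗ N) (n + 3)) (hy : e • y = 0) :
    map π (resTensorHom C N π ≫ (ι ⊗ₘ 𝟙 (Rep.res π N))) (n + 3) y = 0 := by
  obtain ⟨x, rfl⟩ := (hC.cupProductRep_self_bijective N (n + 1)).2 y
  have hx : e • x = 0 := by
    apply (hC.cupProductRep_self_bijective N (n + 1)).1
    change cupProductRep C N (Nat.add_comm 2 (n + 1)) (H2π C φ) (e • x) =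
      cupProductRep C N (Nat.add_comm 2 (n + 1)) (H2π C φ) 0
    rw [map_nsmul, map_zero]
    exact hy
  exact map_cupProductRep_H2π_eq_zero_of_nsmul_eq_zero π ι φ φ₁ hι he (by omega) x hx

/-- `addOrderOf`-form of `IsClassModule.map_eq_zero_of_nsmul_eq_zero`: a class whose order divides the tower
constant dies. [cite: MilneADT2006, Ch. I, Lemma 1.9] [cite: Harari2020, Lemma 16.20] -/
theorem IsClassModule.map_eq_zero_of_addOrderOf_dvd (hC : IsClassModule C φ) (N : Rep.{0} ℤ G)
    [IsAddTorsionFree N.V] (φ₁ : cocycles₂ C₁) {d : ℕ} (hι : map π ι 2 (H2π C φ) = d • H2π C₁ φ₁)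
    (n : ℕ) (y : groupCohomology (C ⊗ N) (n + 3)) (hy : addOrderOf y ∣ d) :
    map π (resTensorHom C N π ≫ (ι ⊗ₘ 𝟙 (Rep.res π N))) (n + 3) y = 0 :=
  hC.map_eq_zero_of_nsmul_eq_zero π ι N φ₁ hι hy n y (addOrderOf_nsmul_eq_zero y)

/-- **Plain coefficients.**  For a class module `(G, C, [φ])` (`G` finite), `π : G₁ → G`, a `G₁`-module `C₁`
with a `2`-cocycle `φ₁`, a `G₁`-map `ι : Res_π C → C₁` with `Inf_π[φ] = d·[φ₁]`, and `e ∣ d`: every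
`y ∈ Hⁿ⁺³(G, C)` with `e · y = 0` satisfies `Inf_π y = 0` (the case `N = ℤ`, the trivial tensor factor removed by
the right unitor, whose inverse on cohomology is additive).
[cite: MilneADT2006, Ch. I, Lemma 1.9] [cite: Harari2020, Lemma 16.20, §16.4 Remark 16.24 (b)] -/
theorem IsClassModule.map_eq_zero_of_nsmul_eq_zero_plain (hC : IsClassModule C φ) (φ₁ : cocycles₂ C₁)
    {d e : ℕ} (hι : map π ι 2 (H2π C φ) = d • H2π C₁ φ₁) (he : e ∣ d) (n : ℕ)
    (y : groupCohomology C (n + 3)) (hy : e • y = 0) : map π ι (n + 3) y = 0 := by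
  -- `y = ρ_* y'` with `y' := ρ⁻¹_* y`, and `e · y' = ρ⁻¹_* (e · y) = 0`
  have hsec : map (A := C ⊗ Rep.trivial ℤ G ℤ) (MonoidHom.id G) (ρ_ C).hom (n + 3)
      (map (A := C) (B := C ⊗ Rep.trivial ℤ G ℤ) (MonoidHom.id G) (ρ_ C).inv (n + 3) y) = y := by
    rw [← CategoryTheory.comp_apply, ← map_id_comp, Iso.inv_hom_id]
    erw [map_id]
    rfl
  have hy' : e • map (A := C) (B := C ⊗ Rep.trivial ℤ G ℤ) (MonoidHom.id G) (ρ_ C).inv (n + 3) y = 0 := by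
    rw [← map_nsmul, hy, map_zero]
  rw [← hsec, map_map_rightUnitor_apply,
    hC.map_eq_zero_of_nsmul_eq_zero π ι (Rep.trivial ℤ G ℤ) φ₁ hι he n _ hy', map_zero]

/-- `addOrderOf`-form of `IsClassModule.map_eq_zero_of_nsmul_eq_zero_plain`.
[cite: MilneADT2006, Ch. I, Lemma 1.9] [cite: Harari2020, Lemma 16.20] -/
theorem IsClassModule.map_eq_zero_of_addOrderOf_dvd_plain (hC : IsClassModule C φ) (φ₁ : cocycles₂ C₁)
    {d : ℕ} (hι : map π ι 2 (H2π C φ) = d • H2π C₁ φ₁) (n : ℕ) (y : groupCohomology C (n + 3))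
    (hy : addOrderOf y ∣ d) : map π ι (n + 3) y = 0 :=
  hC.map_eq_zero_of_nsmul_eq_zero_plain π ι φ₁ hι hy n y (addOrderOf_nsmul_eq_zero y)

/-- **`Hom`-coefficients.**  For a class module `(G, C, [φ])` (`G` finite), a `G`-lattice `N`, `π : G₁ → G`, a
`G₁`-module `C₁` with a `2`-cocycle `φ₁`, a `G₁`-map `ι : Res_π C → C₁` with `Inf_π[φ] = d·[φ₁]`, a `G₁`-lattice
`N₁` identified with `Res_π N` by `e₁` (`e₁ (g·x) = π(g)·e₁(x)`), and `e ∣ d`: every `y ∈ Hⁿ⁺³(G, Hom(N, C))`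
with `e · y = 0` dies under `Hⁿ⁺³(G, Hom(N, C)) → Hⁿ⁺³(G₁, Hom(N₁, C₁))` along `(π, F ↦ ι ∘ F ∘ e₁)`
(`Hom(N, C) ≅ C ⊗ N^∨` with the inverse additive on cohomology, then the tensor form for the torsion-free `N^∨`).
[cite: MilneADT2006, Ch. I, Lemma 1.9] [cite: Harari2020, §16.2 Prop. 16.16 (b), Lemma 16.20, Remark 16.24 (b)] -/
theorem IsClassModule.map_ihom_eq_zero_of_nsmul_eq_zero (hC : IsClassModule C φ) (N : Rep.{0} ℤ G)
    [@Module.Free ℤ N.V _ _ N.hV2] [@Module.Finite ℤ N.V _ _ N.hV2] (φ₁ : cocycles₂ C₁) {d e : ℕ}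
    (hι : map π ι 2 (H2π C φ) = d • H2π C₁ φ₁) (he : e ∣ d)
    (N₁ : Rep.{0} ℤ G₁)
    -- the `Module ℤ` structures are the ones the `Rep` objects carry (not `AddCommGroup.toIntModule`)
    (e₁ : letI := N₁.hV2; letI := N.hV2; N₁.V ≃ₗ[ℤ] N.V)
    (he₁ : ∀ (g : G₁) (x : N₁.V), e₁ (N₁.ρ g x) = N.ρ (π g) (e₁ x))
    (n : ℕ) (y : groupCohomology ((Rep.ihom N).obj C) (n + 3)) (hy : e • y = 0) :
    map π (ihomTransition π C N C₁ N₁ ι e₁ he₁) (n + 3) y = 0 := by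
  haveI : IsAddTorsionFree (dualRep N).V := ⟨fun {m} hm f g hfg => by
    letI := N.hV2
    exact LinearMap.ext fun x => nsmul_right_injective hm (LinearMap.congr_fun hfg x)⟩
  -- `y = t_* y'` with `y' := t⁻¹_* y` (`t : C ⊗ N^∨ ≅ Hom(N, C)`), and `e · y' = t⁻¹_* (e · y) = 0`
  have hsec : map (A := C ⊗ dualRep N) (MonoidHom.id G) (tensorDualHom C N) (n + 3)
      (map (A := (Rep.ihom N).obj C) (B := C ⊗ dualRep N) (MonoidHom.id G) (tensorDualIso C N).inv
        (n + 3) y) = y := by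
    rw [← CategoryTheory.comp_apply, ← map_id_comp, ← tensorDualIso_hom, Iso.inv_hom_id]
    erw [map_id]
    rfl
  have hy' : e • map (A := (Rep.ihom N).obj C) (B := C ⊗ dualRep N) (MonoidHom.id G)
      (tensorDualIso C N).inv (n + 3) y = 0 := by
    rw [← map_nsmul, hy, map_zero]
  rw [← hsec, ← CategoryTheory.comp_apply, map_tensorDualHom_comp_map_ihomTransition,
    CategoryTheory.comp_apply, hC.map_eq_zero_of_nsmul_eq_zero π ι (dualRep N) φ₁ hι he n _ hy', map_zero]

/-- `addOrderOf`-form of `IsClassModule.map_ihom_eq_zero_of_nsmul_eq_zero`.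
[cite: MilneADT2006, Ch. I, Lemma 1.9] [cite: Harari2020, Lemma 16.20] -/
theorem IsClassModule.map_ihom_eq_zero_of_addOrderOf_dvd (hC : IsClassModule C φ) (N : Rep.{0} ℤ G)
    [@Module.Free ℤ N.V _ _ N.hV2] [@Module.Finite ℤ N.V _ _ N.hV2] (φ₁ : cocycles₂ C₁) {d : ℕ}
    (hι : map π ι 2 (H2π C φ) = d • H2π C₁ φ₁) (N₁ : Rep.{0} ℤ G₁)
    (e₁ : letI := N₁.hV2; letI := N.hV2; N₁.V ≃ₗ[ℤ] N.V)
    (he₁ : ∀ (g : G₁) (x : N₁.V), e₁ (N₁.ρ g x) = N.ρ (π g) (e₁ x))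
    (n : ℕ) (y : groupCohomology ((Rep.ihom N).obj C) (n + 3)) (hy : addOrderOf y ∣ d) :
    map π (ihomTransition π C N C₁ N₁ ι e₁ he₁) (n + 3) y = 0 :=
  hC.map_ihom_eq_zero_of_nsmul_eq_zero π ι N φ₁ hι hy N₁ e₁ he₁ n y (addOrderOf_nsmul_eq_zero y)

end ClassModule

end Literature.Algebra.Homology

end
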